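import Summits.FinalStateConjecture.FinalStateConjecture.Theorems.ClusterCompletenessAdiabaticMultiKerrILEDLeafHardyExterior
import Summits.FinalStateConjecture.FinalStateConjecture.Theorems.ClusterCompletenessAdiabaticMultiKerrILEDSlabBookkeeping
import Literature.Geometry.Lorentzian.KerrHorizonRegularWaveBoundednessProofs

/-!
# Route ClusterCompleteness — crux `AdiabaticMultiKerrILED`, line `Sketch`:
# leaf-level inputs for the rest-frame ILED assembly (zero spin)

Helper file for the crux `stmt-FinalStateConjecture-14310`
(`Summit.FinalStateConjecture.FinalStateConjecture.Theses.ClusterCompleteness.AdiabaticMultiKerrILED`),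
line `Sketch` (lead c7, wave 9): (i) the operator norm of a functional on `ℝ³` is bounded by its
coordinate values, (ii) the gradient of a function restricted to a graph leaf `y ↦ Φ(t + F(y), y)`
of slope `≤ 1/2` is bounded by `2 ∑_μ (∂_μΦ)²`, (iii) the leaf `L²`-mass on `{2M < ‖y‖ ≤ 9M}` is
bounded by the leaf energy (Hardy inequality `leaf_hardy_exterior`), (iv) the Hardy decay of a
first derivative on a leaf from finite energy. Registered anchor: `leaf_mass_le_energy`.
[folklore]
-/

noncomputable section

-- the doubled `FinalStateConjecture.FinalStateConjecture` path component trips dupNamespace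
set_option linter.dupNamespace false

open Set MeasureTheory
open scoped ENNReal
open Literature.Geometry.Lorentzian

namespace Summit.FinalStateConjecture.FinalStateConjecture.Theorems

/-- The operator norm of a linear functional on `ℝ³` is bounded by the Euclidean norm of its
coordinate values: `‖ℓ‖² ≤ ∑_i ℓ(e_i)²` (Cauchy–Schwarz on `v = ∑ v_i e_i`). [folklore] -/
theorem opNorm_sq_le_sum_sq_single (ℓ : E3 →L[ℝ] ℝ) :
    ‖ℓ‖ ^ 2 ≤ ∑ i : Fin 3, ℓ (EuclideanSpace.single i 1) ^ 2 := by
  set S : ℝ := ∑ i : Fin 3, ℓ (EuclideanSpace.single i 1) ^ 2 with hS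
  have hS0 : 0 ≤ S := Finset.sum_nonneg fun i _ ↦ sq_nonneg _
  have hbound : ∀ v : E3, ‖ℓ v‖ ≤ Real.sqrt S * ‖v‖ := by
    intro v
    have hv : v = ∑ i : Fin 3, v i • EuclideanSpace.single i (1 : ℝ) := by
      conv_lhs => rw [← (EuclideanSpace.basisFun (Fin 3) ℝ).sum_repr v]
      simp only [EuclideanSpace.basisFun_repr, EuclideanSpace.basisFun_apply]
    have hℓv : ℓ v = ∑ i : Fin 3, v i * ℓ (EuclideanSpace.single i 1) := by
      conv_lhs => rw [hv]
      simp only [map_sum, map_smul, smul_eq_mul]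
    have hcs := Finset.sum_mul_sq_le_sq_mul_sq Finset.univ (fun i : Fin 3 ↦ v i)
      (fun i : Fin 3 ↦ ℓ (EuclideanSpace.single i 1))
    have hvn : ∑ i : Fin 3, v i ^ 2 = ‖v‖ ^ 2 := by
      rw [EuclideanSpace.norm_sq_eq]
      exact Finset.sum_congr rfl fun i _ ↦ by rw [Real.norm_eq_abs, sq_abs]
    rw [Real.norm_eq_abs, ← Real.sqrt_sq (abs_nonneg _), sq_abs, hℓv]
    calc Real.sqrt ((∑ i : Fin 3, v i * ℓ (EuclideanSpace.single i 1)) ^ 2)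
        ≤ Real.sqrt ((∑ i : Fin 3, v i ^ 2) * S) := Real.sqrt_le_sqrt (by rw [hS]; exact hcs)
      _ = Real.sqrt S * ‖v‖ := by
          rw [hvn, Real.sqrt_mul (sq_nonneg _), Real.sqrt_sq (norm_nonneg _), mul_comm]
  have hop : ‖ℓ‖ ≤ Real.sqrt S :=
    ContinuousLinearMap.opNorm_le_bound _ (Real.sqrt_nonneg _) hbound
  calc ‖ℓ‖ ^ 2 ≤ (Real.sqrt S) ^ 2 := pow_le_pow_left₀ (norm_nonneg _) hop 2
    _ = S := Real.sq_sqrt hS0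

/-- **Gradient along a tilted leaf**: for a height `F` of slope `‖dF‖ ≤ 1/2` and `Φ`
differentiable at the leaf point, the gradient of `y ↦ Φ(t + F(y), y)` satisfies
`‖d(Φ ∘ leaf)‖² ≤ 2 ∑_μ (∂_μΦ)²(leaf point)` (chain rule `Kerr.fderiv_comp_graphMap` and
`∑ (∂_iF)² ≤ 1/4`). [folklore] -/
theorem leaf_gradient_sq_le {F : E3 → ℝ} {Φ : E4 → ℝ} {t : ℝ} {y : E3}
    (hF : DifferentiableAt ℝ F y) (hdF : ‖fderiv ℝ F y‖ ≤ 2⁻¹)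
    (hΦ : DifferentiableAt ℝ Φ (E4.ofTimeSpace (t + F y) y)) :
    ‖fderiv ℝ (fun y ↦ Φ (E4.ofTimeSpace (t + F y) y)) y‖ ^ 2 ≤
      2 * ∑ μ : Fin 4, fderiv ℝ Φ (E4.ofTimeSpace (t + F y) y) (E4.basisVector μ) ^ 2 := by
  set x := E4.ofTimeSpace (t + F y) y with hx
  set T : ℝ := fderiv ℝ Φ x (E4.basisVector 0) with hT
  have hcomp : ∀ i : Fin 3, fderiv ℝ (fun y ↦ Φ (E4.ofTimeSpace (t + F y) y)) y
      (EuclideanSpace.single i 1) = Kerr.partialE3 F y i * T + fderiv ℝ Φ x (E4.basisVector i.succ) :=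
    fun i ↦ Kerr.fderiv_comp_graphMap hF t hΦ i
  have hsum : ∑ μ : Fin 4, fderiv ℝ Φ x (E4.basisVector μ) ^ 2 =
      T ^ 2 + ∑ i : Fin 3, fderiv ℝ Φ x (E4.basisVector i.succ) ^ 2 := by
    rw [Fin.sum_univ_succ]
  have hpF : ∑ i : Fin 3, Kerr.partialE3 F y i ^ 2 ≤ 4⁻¹ :=
    (Kerr.sum_sq_partialE3_le F y).trans (by nlinarith [norm_nonneg (fderiv ℝ F y)])
  calc ‖fderiv ℝ (fun y ↦ Φ (E4.ofTimeSpace (t + F y) y)) y‖ ^ 2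
      ≤ ∑ i : Fin 3, fderiv ℝ (fun y ↦ Φ (E4.ofTimeSpace (t + F y) y)) y
          (EuclideanSpace.single i 1) ^ 2 := opNorm_sq_le_sum_sq_single _
    _ = ∑ i : Fin 3, (Kerr.partialE3 F y i * T + fderiv ℝ Φ x (E4.basisVector i.succ)) ^ 2 :=
        Finset.sum_congr rfl fun i _ ↦ by rw [hcomp i]
    _ ≤ ∑ i : Fin 3, (2 * (Kerr.partialE3 F y i) ^ 2 * T ^ 2 +
          2 * fderiv ℝ Φ x (E4.basisVector i.succ) ^ 2) :=
        Finset.sum_le_sum fun i _ ↦ by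
          nlinarith [sq_nonneg (Kerr.partialE3 F y i * T - fderiv ℝ Φ x (E4.basisVector i.succ))]
    _ = 2 * T ^ 2 * ∑ i : Fin 3, Kerr.partialE3 F y i ^ 2 +
          2 * ∑ i : Fin 3, fderiv ℝ Φ x (E4.basisVector i.succ) ^ 2 := by
        rw [Finset.sum_add_distrib, Finset.mul_sum, Finset.mul_sum]
        refine congrArg₂ (· + ·) (Finset.sum_congr rfl fun i _ ↦ by ring) rfl
    _ ≤ 2 * T ^ 2 * 4⁻¹ + 2 * ∑ i : Fin 3, fderiv ℝ Φ x (E4.basisVector i.succ) ^ 2 := by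
        have h2T : 0 ≤ 2 * T ^ 2 := by positivity
        nlinarith [mul_le_mul_of_nonneg_left hpF h2T]
    _ ≤ 2 * ∑ μ : Fin 4, fderiv ℝ Φ x (E4.basisVector μ) ^ 2 := by
        rw [hsum]; nlinarith [sq_nonneg T]

/-- **Leaf mass by leaf energy** (registered anchor `leaf_mass_le_energy`): for `M > 0` there
is `C` with `∫_{2M<‖y‖≤9M} Φ(t+F(y),y)² ≤ C ∫_{2M<‖y‖} ∑_μ(∂_μΦ)²(t+F(y),y)` for every `C¹`
height `F` of slope `≤ 1/2`, every `C¹` function `Φ`, and every `t`, provided the leaf function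
has the Hardy decay `∫_{ρ₀<‖y‖} Φ(leaf)²/‖y‖² < ∞` for some `ρ₀` (`‖y‖ ≤ 9M` on the shell,
`leaf_hardy_exterior`, `leaf_gradient_sq_le`). [folklore] -/
theorem leaf_mass_le_energy : ∀ (M : ℝ), 0 < M → ∃ C : NNReal, ∀ (F : E3 → ℝ) (Φ : E4 → ℝ) (t : ℝ), ContDiff ℝ 1 F → (∀ y, ‖fderiv ℝ F y‖ ≤ 2⁻¹) → ContDiff ℝ 1 Φ → (∃ ρ₀ : ℝ, ∫⁻ y in {y : E3 | ρ₀ < ‖y‖}, ENNReal.ofReal (Φ (E4.ofTimeSpace (t + F y) y) ^ 2 / ‖y‖ ^ 2) < ⊤) → ∫⁻ y in {y : E3 | 2 * M < ‖y‖ ∧ ‖y‖ ≤ 9 * M}, ENNReal.ofReal (Φ (E4.ofTimeSpace (t + F y) y) ^ 2) ≤ (C : ENNReal) * ∫⁻ y in {y : E3 | 2 * M < ‖y‖}, ENNReal.ofReal (∑ μ : Fin 4, fderiv ℝ Φ (E4.ofTimeSpace (t + F y) y) (E4.basisVector μ) ^ 2) := by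
  intro M hM
  obtain ⟨CH, hCH⟩ := leaf_hardy_exterior M hM
  set Ktot : ℝ≥0∞ := ENNReal.ofReal (81 * M ^ 2) * ((CH : ℝ≥0∞) * ENNReal.ofReal 2) with hKtot
  have hKfin : Ktot ≠ ⊤ := by simp only [hKtot]; finiteness
  refine ⟨Ktot.toNNReal, ?_⟩
  intro F Φ t hF hdF hΦ hdec
  rw [ENNReal.coe_toNNReal hKfin]
  set u : E3 → ℝ := fun y ↦ Φ (E4.ofTimeSpace (t + F y) y) with hu
  have hleafC1 : ContDiff ℝ 1 fun y : E3 ↦ E4.ofTimeSpace (t + F y) y := by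
    have h : (fun y : E3 ↦ E4.ofTimeSpace (t + F y) y) =
        fun y ↦ (t + F y) • E4.basisVector 0 + E4.spaceEmbed y :=
      funext fun y ↦ E4.ofTimeSpace_eq_smul_add' _ _
    rw [h]
    exact ((contDiff_const.add hF).smul contDiff_const).add E4.spaceEmbed.contDiff
  have huC1 : ContDiff ℝ 1 u := hΦ.comp hleafC1
  have h1 := hCH u (fun y _ ↦ huC1.contDiffAt) hdec
  have hmain : ∫⁻ y in {y : E3 | 2 * M < ‖y‖ ∧ ‖y‖ ≤ 9 * M}, ENNReal.ofReal (u y ^ 2) ≤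
      ENNReal.ofReal (81 * M ^ 2) * ((CH : ℝ≥0∞) * (ENNReal.ofReal 2 * ∫⁻ y in {y : E3 | 2 * M < ‖y‖},
        ENNReal.ofReal (∑ μ : Fin 4, fderiv ℝ Φ (E4.ofTimeSpace (t + F y) y) (E4.basisVector μ) ^ 2))) := by
    calc ∫⁻ y in {y : E3 | 2 * M < ‖y‖ ∧ ‖y‖ ≤ 9 * M}, ENNReal.ofReal (u y ^ 2)
        ≤ ∫⁻ y in {y : E3 | 2 * M < ‖y‖ ∧ ‖y‖ ≤ 9 * M},
            ENNReal.ofReal (81 * M ^ 2) * ENNReal.ofReal (u y ^ 2 / ‖y‖ ^ 2) := by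
          refine setLIntegral_mono' (measurableSet_norm_Ioc _ _) fun y hy ↦ ?_
          rw [← ENNReal.ofReal_mul (by positivity)]
          refine ENNReal.ofReal_le_ofReal ?_
          have hy0 : 0 < ‖y‖ := by linarith [hy.1]
          rw [mul_div_assoc', le_div_iff₀ (by positivity)]
          have : ‖y‖ ^ 2 ≤ 81 * M ^ 2 := by nlinarith [hy.1, hy.2, norm_nonneg y]
          nlinarith [sq_nonneg (u y)]
      _ = ENNReal.ofReal (81 * M ^ 2) * ∫⁻ y in {y : E3 | 2 * M < ‖y‖ ∧ ‖y‖ ≤ 9 * M},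
            ENNReal.ofReal (u y ^ 2 / ‖y‖ ^ 2) := lintegral_const_mul' _ _ ENNReal.ofReal_ne_top
      _ ≤ ENNReal.ofReal (81 * M ^ 2) * ∫⁻ y in {y : E3 | 2 * M < ‖y‖},
            ENNReal.ofReal (u y ^ 2 / ‖y‖ ^ 2) :=
          mul_le_mul_right (lintegral_mono_set fun y hy ↦ hy.1) _
      _ ≤ ENNReal.ofReal (81 * M ^ 2) * ((CH : ℝ≥0∞) * ∫⁻ y in {y : E3 | 2 * M < ‖y‖},
            ENNReal.ofReal (‖fderiv ℝ u y‖ ^ 2)) := mul_le_mul_right h1 _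
      _ ≤ ENNReal.ofReal (81 * M ^ 2) * ((CH : ℝ≥0∞) * ∫⁻ y in {y : E3 | 2 * M < ‖y‖},
            ENNReal.ofReal 2 * ENNReal.ofReal (∑ μ : Fin 4,
              fderiv ℝ Φ (E4.ofTimeSpace (t + F y) y) (E4.basisVector μ) ^ 2)) := by
          refine mul_le_mul_right (mul_le_mul_right (setLIntegral_mono' (measurableSet_norm_Ioi _)
            fun y _ ↦ ?_) _) _
          rw [← ENNReal.ofReal_mul (by norm_num)]
          exact ENNReal.ofReal_le_ofReal (leaf_gradient_sq_le (hF.differentiable one_ne_zero y)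
            (hdF y) ((hΦ.differentiable one_ne_zero) _))
      _ = _ := by rw [lintegral_const_mul' _ _ ENNReal.ofReal_ne_top]
  refine hmain.trans_eq ?_
  simp only [hKtot]
  ring

/-- **Hardy decay of a first derivative from finite leaf energy**: for `0 < ρ`, `2M ≤ ρ`,
`∫_{ρ<‖y‖} (∂₀Φ)²(leaf)/‖y‖² ≤ ρ⁻² ∫_{2M<‖y‖} ∑_μ(∂_μΦ)²(leaf)`. [folklore] -/
theorem leaf_hardyDecay_of_energy {M ρ : ℝ} (hρ : 0 < ρ) (hMρ : 2 * M ≤ ρ) (F : E3 → ℝ)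
    (Φ : E4 → ℝ) (t : ℝ) :
    ∫⁻ y in {y : E3 | ρ < ‖y‖}, ENNReal.ofReal
        (fderiv ℝ Φ (E4.ofTimeSpace (t + F y) y) (E4.basisVector 0) ^ 2 / ‖y‖ ^ 2) ≤
      ENNReal.ofReal (ρ ^ 2)⁻¹ * ∫⁻ y in {y : E3 | 2 * M < ‖y‖}, ENNReal.ofReal
        (∑ μ : Fin 4, fderiv ℝ Φ (E4.ofTimeSpace (t + F y) y) (E4.basisVector μ) ^ 2) := by
  calc ∫⁻ y in {y : E3 | ρ < ‖y‖}, ENNReal.ofReal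
        (fderiv ℝ Φ (E4.ofTimeSpace (t + F y) y) (E4.basisVector 0) ^ 2 / ‖y‖ ^ 2)
      ≤ ∫⁻ y in {y : E3 | ρ < ‖y‖}, ENNReal.ofReal (ρ ^ 2)⁻¹ * ENNReal.ofReal
          (∑ μ : Fin 4, fderiv ℝ Φ (E4.ofTimeSpace (t + F y) y) (E4.basisVector μ) ^ 2) := by
        refine setLIntegral_mono' (measurableSet_norm_Ioi _) fun y hy ↦ ?_
        rw [← ENNReal.ofReal_mul (by positivity)]
        refine ENNReal.ofReal_le_ofReal ?_
        have hy' : ρ < ‖y‖ := hy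
        have hy0 : 0 < ‖y‖ := hρ.trans hy'
        have hT : fderiv ℝ Φ (E4.ofTimeSpace (t + F y) y) (E4.basisVector 0) ^ 2 ≤
            ∑ μ : Fin 4, fderiv ℝ Φ (E4.ofTimeSpace (t + F y) y) (E4.basisVector μ) ^ 2 :=
          Finset.single_le_sum (f := fun μ : Fin 4 ↦
            fderiv ℝ Φ (E4.ofTimeSpace (t + F y) y) (E4.basisVector μ) ^ 2)
            (fun μ _ ↦ sq_nonneg _) (Finset.mem_univ 0)
        rw [div_le_iff₀ (by positivity), inv_mul_eq_div, div_mul_eq_mul_div, le_div_iff₀ (by positivity)]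
        have hρy : ρ ^ 2 ≤ ‖y‖ ^ 2 := by nlinarith [norm_nonneg y]
        have h0 : 0 ≤ fderiv ℝ Φ (E4.ofTimeSpace (t + F y) y) (E4.basisVector 0) ^ 2 := sq_nonneg _
        nlinarith [mul_le_mul hT hρy (by positivity) (Finset.sum_nonneg fun μ _ ↦ sq_nonneg _)]
    _ = ENNReal.ofReal (ρ ^ 2)⁻¹ * ∫⁻ y in {y : E3 | ρ < ‖y‖}, ENNReal.ofReal
          (∑ μ : Fin 4, fderiv ℝ Φ (E4.ofTimeSpace (t + F y) y) (E4.basisVector μ) ^ 2) :=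
        lintegral_const_mul' _ _ ENNReal.ofReal_ne_top
    _ ≤ _ := mul_le_mul_right (lintegral_mono_set fun y (hy : ρ < ‖y‖) ↦
        show 2 * M < ‖y‖ from lt_of_le_of_lt hMρ hy) _

end Summit.FinalStateConjecture.FinalStateConjecture.Theorems

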